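import Summits.MatrixMultiplication.MatrixMultiplication.Theorems.TetrahedronTensor
import Literature.Computability.AlgebraicComplexity.GraphTensor
import HarnessLib

/-!
# TetrahedronTensorGraphBridge — the tree's tetrahedron tensor `tetra` IS the Literature graph tensor
# `graphTensor tetraSlots`, so `omegaTetra = graphOmega tetraSlots` and the printed bounds apply by name

(decomp-mm lens 6 «barrier-complement carving», gen 15; suggested by decomp-mm-writer-1, NOTE
2026-08-30T16:24:37Z, after the definition item `defn-GraphTensor` landed as
`Literature/Computability/AlgebraicComplexity/GraphTensor.lean`.)

The slot table `Literature.….tetraSlots = ![![0,1,2],![0,3,4],![1,3,5],![2,4,5]]` is literally the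
table of `TetrahedronTensorCore.vertexLabels`, so the rank-one legs agree (`legVec_eq_graphLeg`),
`tetra F n = graphTensor F tetraSlots n` (`tetra_eq_graphTensor`, via `tetra_eq_sum`), the exponent
sets agree (`tetraAdmissibleExponents_eq_graphExponents`) and
`omegaTetra F = graphOmega F tetraSlots` (`omegaTetra_eq_graphOmega`); in the clique presentation
`omegaTetra F = graphOmega F (cliqueSlots 3) = 6 · graphTau F (cliqueSlots 3)`.

Pay-offs for the route of record `TetrahedronCarving` (crux `TetraFlat : omegaTetra ℂ ≤ 4`):
* `TetraFlat` in Literature currency: `omegaTetra ℂ ≤ 4 ↔ graphTau ℂ (cliqueSlots 3) ≤ 2/3`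
  (`omegaTetra_le_four_iff_graphTau_le`) — CVZ19 Problem 1.2.1 / Question 1.3.2 at `K₄`.
* The printed ceiling as BY-NAME CONDITIONAL RUNGS: `cvz19_cor_1_2_6 → omegaTetra ℂ ≤ 6·log₇(9/2)`
  (`≈ 4.63766`) and `brandEtAl2026_thm_48 → omegaTetra ℂ < 4.633908` (the ladder `6 → 4.638 → 4.634`,
  target `4`).
* The tree's unconditional `omegaTetra_le_two_mul_omega` discharges the `K₄` instance of the named
  fact `cvz19_prop_1_1_26`: `graphOmega F tetraSlots ≤ 2ω` and `graphTau F (cliqueSlots 3) ≤ ω/3` for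
  every field, no hypothesis.
No `sorry`, no new axiom, no instance, no notation, no `Prop`-valued definition.
-/

noncomputable section

set_option linter.dupNamespace false

open scoped BigOperators
open Filter Asymptotics
open Literature.Computability.AlgebraicComplexity

namespace Summit.MatrixMultiplication.MatrixMultiplication.Theorems.TetrahedronTensor

variable (F : Type*) [Field F]

/-- The tree's slot table is the Literature one: `vertexLabels e v = fun j => e (tetraSlots v j)`.
[cite: ChristandlVranaZuiddam2016, Ex. 1.1.2] -/
theorem vertexLabels_eq_tetraSlots {n : ℕ} (e : Fin 6 → Fin n) (v : Fin 4) :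
    vertexLabels e v = fun j => e (tetraSlots v j) := by
  funext j
  fin_cases v <;> fin_cases j <;> rfl

/-- The rank-one legs agree: `legVec F e = graphLeg F tetraSlots e`. [cite: ChristandlVranaZuiddam2016, Ex. 1.1.2] -/
theorem legVec_eq_graphLeg {n : ℕ} (e : Fin 6 → Fin n) : legVec F e = graphLeg F tetraSlots e := by
  funext v
  simp only [legVec, graphLeg, slotIndex, vertexLabels_eq_tetraSlots]

/-- **The bridge.** The tree's tetrahedron tensor is the Literature graph tensor of `K₄` in the slot
presentation `tetraSlots`: `tetra F n = graphTensor F tetraSlots n`. [cite: ChristandlVranaZuiddam2016, Ex. 1.1.2] -/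
theorem tetra_eq_graphTensor (n : ℕ) : tetra F n = graphTensor F tetraSlots n := by
  rw [tetra_eq_sum]
  unfold graphTensor
  exact Finset.sum_congr rfl fun e _ => by rw [legVec_eq_graphLeg]

/-- … and in the clique presentation: `tetra F n = graphTensor F (cliqueSlots 3) n`.
[cite: ChristandlVranaZuiddam2016, Ex. 1.1.2] -/
theorem tetra_eq_graphTensor_cliqueSlots (n : ℕ) : tetra F n = graphTensor F (cliqueSlots 3) n := by
  rw [tetra_eq_graphTensor, graphTensor_cliqueSlots_three]

/-- The exponent sets agree. [cite: ChristandlVranaZuiddam2016, Prop. 1.1.18] -/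
theorem tetraAdmissibleExponents_eq_graphExponents :
    tetraAdmissibleExponents F = graphExponents F tetraSlots := by
  ext β
  simp only [tetraAdmissibleExponents, graphExponents, Set.mem_setOf_eq, tetra_eq_graphTensor]

/-- **`ω(K₄)` of the tree is `ω(T(K₄))` of the Literature**: `omegaTetra F = graphOmega F tetraSlots`.
[cite: ChristandlVranaZuiddam2016, Def. 1.1.25] -/
theorem omegaTetra_eq_graphOmega : omegaTetra F = graphOmega F tetraSlots := by
  unfold omegaTetra graphOmega
  rw [tetraAdmissibleExponents_eq_graphExponents]

/-- Clique presentation: `omegaTetra F = graphOmega F (cliqueSlots 3)`. [cite: ChristandlVranaZuiddam2016, Def. 1.1.25] -/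
theorem omegaTetra_eq_graphOmega_cliqueSlots : omegaTetra F = graphOmega F (cliqueSlots 3) := by
  rw [omegaTetra_eq_graphOmega, graphOmega_cliqueSlots_three]

/-- Exponent per edge: `graphTau F (cliqueSlots 3) = omegaTetra F / 6`. [cite: ChristandlVranaZuiddam2016, Def. 1.1.25] -/
theorem graphTau_cliqueSlots_three_eq : graphTau F (cliqueSlots 3) = omegaTetra F / 6 := by
  rw [graphTau_cliqueSlots_three, omegaTetra_eq_graphOmega]

/-- **`TetraFlat` in Literature currency**: `omegaTetra F ≤ 4 ↔ τ(T(K₄)) ≤ 2/3` (CVZ19 Problem 1.2.1 /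
Question 1.3.2 at `K₄`: does `T(K₄)` sit at its flattening exponent per edge `4/6`?).
[cite: ChristandlVranaZuiddam2016, Problem 1.2.1] -/
theorem omegaTetra_le_four_iff_graphTau_le : omegaTetra F ≤ 4 ↔ graphTau F (cliqueSlots 3) ≤ 2 / 3 := by
  rw [graphTau_cliqueSlots_three_eq]
  constructor <;> intro h <;> linarith

/-- The `K₄` instance of the named fact `cvz19_prop_1_1_26`, DISCHARGED by the tree for every field:
`graphOmega F tetraSlots ≤ 2ω` (from `omegaTetra_le_two_mul_omega`). [cite: ChristandlVranaZuiddam2016, Prop. 1.1.26] -/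
theorem graphOmega_tetraSlots_le_two_mul_omega : graphOmega F tetraSlots ≤ 2 * omega F := by
  rw [← omegaTetra_eq_graphOmega]
  exact omegaTetra_le_two_mul_omega F

/-- … per edge: `graphTau F (cliqueSlots 3) ≤ ω/3`, unconditionally. [cite: ChristandlVranaZuiddam2016, Prop. 1.1.26] -/
theorem graphTau_cliqueSlots_three_le_omega_div_three : graphTau F (cliqueSlots 3) ≤ omega F / 3 := by
  rw [graphTau_cliqueSlots_three_eq]
  have := omegaTetra_le_two_mul_omega F
  linarith

-- The flattening bound `4 ≤ graphOmega F tetraSlots` is already the Literature theorem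
-- `Literature.Computability.AlgebraicComplexity.four_le_graphOmega_tetraSlots` (GraphTensorFlattening);
-- by `omegaTetra_eq_graphOmega` it is the tree's `four_le_omegaTetra`.

/-! ## The printed ceiling as by-name conditional rungs (over `ℂ`) -/

/-- **CVZ19 Cor. 1.2.6 ⟹ `ω(K₄) ≤ 6·log₇(9/2)`** (`≈ 4.63766`). [cite: ChristandlVranaZuiddam2016, Cor. 1.2.6] -/
theorem omegaTetra_le_of_cvz19_cor_1_2_6 (h : cvz19_cor_1_2_6) :
    omegaTetra ℂ ≤ 6 * Real.logb 7 (9 / 2) := by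
  rw [omegaTetra_eq_graphOmega]
  exact h.graphOmega_tetraSlots_le

/-- **Brand et al. 2026 Thm. 48 ⟹ `ω(K₄) < 4.633908`** — the current printed ceiling of the
`TetraFlat` ladder (`6 → 4.638 → 4.634`; target `4`). [cite: BrandEtAl2026, Thm. 48] -/
theorem omegaTetra_lt_of_brandEtAl2026_thm_48 (h : brandEtAl2026_thm_48) : omegaTetra ℂ < 4.633908 := by
  rw [omegaTetra_eq_graphOmega]
  exact h.graphOmega_tetraSlots_lt

/-- Under Thm. 48 the tetrahedron saves STRICTLY over the two-triangle cover as soon as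
`ω ≥ 2.316954`: `brandEtAl2026_thm_48 → 2.316954 ≤ omega ℂ → omegaTetra ℂ < 2 * omega ℂ` — i.e. the
residual `TetraNoSaving : 2ω ≤ ω(K₄)` of the route of record is then FALSE unless `ω < 2.316954`.
[cite: BrandEtAl2026, Thm. 48] -/
theorem omegaTetra_lt_two_mul_omega_of_brandEtAl2026_thm_48 (h : brandEtAl2026_thm_48)
    (hω : 2.316954 ≤ omega ℂ) : omegaTetra ℂ < 2 * omega ℂ := by
  have := omegaTetra_lt_of_brandEtAl2026_thm_48 h
  linarith

/-- Contrapositive form used by the residual: `brandEtAl2026_thm_48 → 2ω ≤ ω(K₄) → ω < 2.316954`.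
[cite: BrandEtAl2026, Thm. 48] -/
theorem omega_lt_of_tetraNoSaving_of_brandEtAl2026_thm_48 (h : brandEtAl2026_thm_48)
    (hB : 2 * omega ℂ ≤ omegaTetra ℂ) : omega ℂ < 2.316954 := by
  have := omegaTetra_lt_of_brandEtAl2026_thm_48 h
  linarith

end Summit.MatrixMultiplication.MatrixMultiplication.Theorems.TetrahedronTensor

end
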